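import Summits.BirchSwinnertonDyer.BirchSwinnertonDyer.Theorems.BiquadraticEisensteinDescentHeegnerTwistCouplingInSupplySymbolicMonskyEvenDesignDoor
import Summits.BirchSwinnertonDyer.BirchSwinnertonDyer.Theorems.BiquadraticEisensteinDescentHeegnerTwistCouplingInSupplySymbolicMonskyEvenDesignMuOne
import HarnessLib

set_option linter.dupNamespace false -- `Summit.BirchSwinnertonDyer.BirchSwinnertonDyer.Theorems.…` (summit = sub)
set_option autoImplicit false

/-!
# Crux `HeegnerTwistCouplingInSupply` (stmt-BirchSwinnertonDyer-21381) — EVEN bases with exactly one prime `≡ ±3 (mod 8)`: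
# at `δ = 1` the `0 × V` section of the even pencil is never larger than the DIAGONAL section, so it never obstructs

Route `BiquadraticEisensteinDescent` (cell `pub/bsd-wall`, width seat `bsd-wall-cm-bed-w3` g24; `--supports` 21381, helper). Companion of
`…SymbolicMonskyEvenDesignMuOne` (p756294: one prime `≡ 3 (mod 4)`). Here the even base `E_{2·P₀⋯P_k}` has root number `−1` (an odd number of
`P_b ≡ 3 (mod 4)`, `hμ`) and EXACTLY ONE prime `P_{b₁}` with `(2/P_{b₁}) = −1` (class 3 or 5 mod 8; all other `P_b ≡ ±1 (mod 8)`). Conjecture (★) of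
memo EVEN-EXCEPTIONAL-CLASS-w3g24 §2b (the `0 × V` condition of EVEN THEOREM A always holds at `δ = 1`) is proved for this family by the mirror
image of the μ = 1 argument, the matrix `B := L + D_d + d·mᵀ` replacing `L + D_d + d·e_{b₀}ᵀ` and the diagonal replacing `V × 0`:
* ★★ `finrank_evenPencil_one_inf_ker_fst_le_diag_of_negTwo_one` — `dim (W_ev(1) ∩ 0×V) ≤ dim (W_ev(1) ∩ Δ)`: the `0 × V` section embeds in
  `0 × ker B` (the two even kernel equations of `(u, γ·1)` add up to `Lu = γ d`, and their sum over all indices gives `⟨m,u⟩ + u_{b₁} + γ = 0`),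
  `{(u,u) : u ∈ ker Bᵀ} ⊆ W_ev(1) ∩ Δ` (the pair `(u, u + u_{b₁}·1)` is an even kernel pair — `Bᵀ` written out by quadratic reciprocity
  `bz_neg_swap`), and `dim ker B = dim ker Bᵀ`;
* ★★ `two_mul_finrank_evenPencil_one_inf_ker_fst_le_of_negTwo_one` — hence `2·dim (W_ev(1) ∩ 0×V) ≤ dim 𝒦_ev + 1 = 2τ₀`;
* ★★★ `exists_patternFree_even_design_one_of_negTwo_one` — two-condition door at `δ = 1` (`V × 0` and diagonal sections `≤ τ₀` ⇒ pattern-free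
  Heegner recipe with `τ₀ + 1` auxiliary primes), and ★★★ `exists_recipe_cruxOn_even_one_of_negTwo_one` — the same through the realisation door
  `RealisesK.cruxOn_even_of_BT_of_forall` (conclusion of `HeegnerTwistCouplingInSupply` at `(E_{2n}, P₀)` for realising primes in the size window,
  modulo Burungale–Tian).
HONEST FRAMING: RUNG-LEVEL corner layer (even congruent `j = 1728` families `E_{2n₀}`); `𝔽₂`-linear algebra attached to Monsky matrices
[cite: HeathBrown1994SelmerCongruentII, Appendix (Monsky), typescript p. 41 L20–L36]; instances need located primes (w4 layer) and the print input
[cite: BurungaleTian2026, Thm. 1.1]; the crux as stated (C⁺), its registered stubs and BSD are NOT touched; nothing is closed. THEOREMS ONLY.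
-/

namespace Summit.BirchSwinnertonDyer.BirchSwinnertonDyer.Theorems.SymbolicMonsky

section NegTwoOneEven

open Module Matrix Literature.NumberTheory.EllipticCurves Literature.NumberTheory.EllipticCurves.HeathBrown1994
  Literature.NumberTheory.EllipticCurves.HeathBrown1994.Families
open Literature.NumberTheory.EllipticCurves.Rank1Residual

variable {k : ℕ} (base : SymbData (k + 1))

/-- Row of `B = L + D_d + d·mᵀ`: `(B w)_i = Σ_j [(P_j/P_i) = −1](w_j + w_i) + d_i w_i + d_i ⟨m,w⟩`. -/
private theorem bmat_mulVec (w : Fin (k + 1) → ZMod 2) (i : Fin (k + 1)) :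
    ((Matrix.of fun i j : Fin (k + 1) => bz (base.neg i j) +
        (if i = j then (∑ l, bz (base.neg i l)) + bz (negTwo (base.cls i)) else 0) +
        bz (negTwo (base.cls i)) * bz (negNegOne (base.cls j))) *ᵥ w) i =
      (∑ j, bz (base.neg i j) * (w j + w i)) + bz (negTwo (base.cls i)) * w i +
        bz (negTwo (base.cls i)) * ∑ j, bz (negNegOne (base.cls j)) * w j := by
  simp only [mulVec, dotProduct, Matrix.of_apply]
  have e1 : (∑ j, (bz (base.neg i j) + (if i = j then (∑ l, bz (base.neg i l)) + bz (negTwo (base.cls i)) else 0) +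
        bz (negTwo (base.cls i)) * bz (negNegOne (base.cls j))) * w j) =
      (∑ j, bz (base.neg i j) * w j) + (∑ j, (if i = j then ((∑ l, bz (base.neg i l)) + bz (negTwo (base.cls i))) * w j else 0)) +
        ∑ j, bz (negTwo (base.cls i)) * bz (negNegOne (base.cls j)) * w j := by
    rw [← Finset.sum_add_distrib, ← Finset.sum_add_distrib]
    refine Finset.sum_congr rfl fun j _ => ?_
    split_ifs <;> ring
  have e2 : (∑ j, bz (base.neg i j) * (w j + w i)) = (∑ j, bz (base.neg i j) * w j) + (∑ l, bz (base.neg i l)) * w i := by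
    rw [Finset.sum_mul, ← Finset.sum_add_distrib]
    exact Finset.sum_congr rfl fun j _ => by ring
  have e3 : (∑ j, bz (negTwo (base.cls i)) * bz (negNegOne (base.cls j)) * w j) =
      bz (negTwo (base.cls i)) * ∑ j, bz (negNegOne (base.cls j)) * w j := by
    rw [Finset.mul_sum]
    exact Finset.sum_congr rfl fun j _ => by ring
  rw [e1, Finset.sum_ite_eq, e2, e3]
  simp only [Finset.mem_univ, if_true]
  ring

/-- Row of `Bᵀ` (quadratic reciprocity): `(Bᵀ u)_j = Σ_i [(P_i/P_j) = −1](u_i + u_j) + m_j ⟨m,u⟩ + m_j u_j + d_j u_j + m_j ⟨d,u⟩`. -/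
private theorem bmatT_mulVec (u : Fin (k + 1) → ZMod 2) (j : Fin (k + 1)) :
    ((Matrix.of fun i j : Fin (k + 1) => bz (base.neg i j) +
        (if i = j then (∑ l, bz (base.neg i l)) + bz (negTwo (base.cls i)) else 0) +
        bz (negTwo (base.cls i)) * bz (negNegOne (base.cls j)))ᵀ *ᵥ u) j =
      (∑ i, bz (base.neg j i) * (u i + u j)) + bz (negNegOne (base.cls j)) * (∑ i, bz (negNegOne (base.cls i)) * u i) +
        bz (negNegOne (base.cls j)) * u j + bz (negTwo (base.cls j)) * u j +
        bz (negNegOne (base.cls j)) * ∑ i, bz (negTwo (base.cls i)) * u i := by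
  have h2 : ∀ x : ZMod 2, x + x = 0 := by decide
  have hsq : ∀ x : ZMod 2, x * x = x := by decide
  simp only [mulVec, dotProduct, transpose_apply, Matrix.of_apply]
  -- pointwise reciprocity `n_ij u_i = n_ji u_i + [i ≠ j] m_j m_i u_i`
  have hpt : ∀ i, (bz (base.neg i j) + (if i = j then (∑ l, bz (base.neg i l)) + bz (negTwo (base.cls i)) else 0) +
        bz (negTwo (base.cls i)) * bz (negNegOne (base.cls j))) * u i =
      bz (base.neg j i) * u i + bz (negNegOne (base.cls j)) * bz (negNegOne (base.cls i)) * u i +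
        (if i = j then ((∑ l, bz (base.neg j l)) + bz (negNegOne (base.cls j)) + bz (negTwo (base.cls j))) * u i else 0) +
        bz (negNegOne (base.cls j)) * (bz (negTwo (base.cls i)) * u i) := by
    intro i
    by_cases hij : i = j
    · subst hij
      rw [if_pos rfl, if_pos rfl]
      linear_combination (-(hsq (bz (negNegOne (base.cls i)))) - h2 (bz (negNegOne (base.cls i)))) * u i
    · have hji : j ≠ i := fun h => hij h.symm
      rw [if_neg hij, if_neg hij, base.bz_neg_swap hji, ← bz_and_mul (negNegOne (base.cls j)) (negNegOne (base.cls i))]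
      ring
  rw [Finset.sum_congr rfl fun i _ => hpt i, Finset.sum_add_distrib, Finset.sum_add_distrib, Finset.sum_add_distrib,
    Finset.sum_ite_eq' Finset.univ j]
  simp only [Finset.mem_univ, if_true]
  have e2 : (∑ i, bz (base.neg j i) * (u i + u j)) = (∑ i, bz (base.neg j i) * u i) + (∑ l, bz (base.neg j l)) * u j := by
    rw [Finset.sum_mul, ← Finset.sum_add_distrib]
    exact Finset.sum_congr rfl fun i _ => by ring
  have e3 : (∑ i, bz (negNegOne (base.cls j)) * bz (negNegOne (base.cls i)) * u i) =
      bz (negNegOne (base.cls j)) * ∑ i, bz (negNegOne (base.cls i)) * u i := by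
    rw [Finset.mul_sum]
    exact Finset.sum_congr rfl fun i _ => by ring
  rw [e2, e3, ← Finset.mul_sum]
  ring

/-- Column sums of the Laplacian: `Σ_i Σ_j [(P_j/P_i) = −1](y_j + y_i) = (1 + μ)⟨m,y⟩` (so `= 0` when `μ` is odd). -/
private theorem sum_lap_eq_d1 (y : Fin (k + 1) → ZMod 2) :
    (∑ i, ∑ j, bz (base.neg i j) * (y j + y i)) =
      (1 + ∑ b, bz (negNegOne (base.cls b))) * ∑ j, bz (negNegOne (base.cls j)) * y j := by
  have h2 : ∀ x : ZMod 2, x + x = 0 := by decide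
  have hsq : ∀ x : ZMod 2, x * x = x := by decide
  have e1 : (∑ i, ∑ j, bz (base.neg i j) * (y j + y i)) = ∑ i, ∑ j, (bz (base.neg j i) + bz (base.neg i j)) * y i := by
    have : (∑ i, ∑ j, bz (base.neg i j) * (y j + y i)) = (∑ i, ∑ j, bz (base.neg i j) * y j) + ∑ i, ∑ j, bz (base.neg i j) * y i := by
      rw [← Finset.sum_add_distrib]
      refine Finset.sum_congr rfl fun i _ => ?_
      rw [← Finset.sum_add_distrib]
      exact Finset.sum_congr rfl fun j _ => by ring
    rw [this, Finset.sum_comm, ← Finset.sum_add_distrib]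
    refine Finset.sum_congr rfl fun i _ => ?_
    rw [← Finset.sum_add_distrib]
    exact Finset.sum_congr rfl fun j _ => by ring
  have e2 : ∀ i, (∑ j, (bz (base.neg j i) + bz (base.neg i j)) * y i) =
      (∑ j, bz (negNegOne (base.cls i)) * bz (negNegOne (base.cls j)) * y i) + bz (negNegOne (base.cls i)) * y i := by
    intro i
    have hpt : ∀ j, (bz (base.neg j i) + bz (base.neg i j)) * y i =
        bz (negNegOne (base.cls i)) * bz (negNegOne (base.cls j)) * y i + (if j = i then bz (negNegOne (base.cls i)) * y i else 0) := by
      intro j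
      by_cases hji : j = i
      · subst hji
        rw [if_pos rfl]
        linear_combination (h2 (bz (base.neg j j))) * y j - (hsq (bz (negNegOne (base.cls j)))) * y j -
          h2 (bz (negNegOne (base.cls j)) * y j)
      · have hij : i ≠ j := fun h => hji h.symm
        rw [if_neg hji, base.bz_neg_swap hij, bz_and_mul]
        linear_combination (h2 (bz (base.neg i j))) * y i
    rw [Finset.sum_congr rfl fun j _ => hpt j, Finset.sum_add_distrib, Finset.sum_ite_eq' Finset.univ i]
    simp only [Finset.mem_univ, if_true]
  rw [e1, Finset.sum_congr rfl fun i _ => e2 i, Finset.sum_add_distrib, add_mul, one_mul, Finset.mul_sum]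
  have e3 : ∀ i, (∑ j, bz (negNegOne (base.cls i)) * bz (negNegOne (base.cls j)) * y i) =
      (∑ b, bz (negNegOne (base.cls b))) * (bz (negNegOne (base.cls i)) * y i) := by
    intro i
    rw [Finset.sum_mul]
    exact Finset.sum_congr rfl fun j _ => by ring
  rw [Finset.sum_congr rfl fun i _ => e3 i, add_comm]

/-- An even root-number-`−1` base (`Σ_b [P_b ≡ 3 (4)] = 1` in `𝔽₂`) has some prime `≡ 3 (mod 4)`. -/
private theorem exists_negNegOne_of_sum (hμ : (∑ b, bz (negNegOne (base.cls b))) = 1) : ∃ b₀, negNegOne (base.cls b₀) = true := by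
  obtain ⟨b₀, -, hb₀⟩ := Finset.exists_ne_zero_of_sum_ne_zero
    (by rw [hμ]; exact one_ne_zero : (∑ b, bz (negNegOne (base.cls b))) ≠ 0)
  refine ⟨b₀, ?_⟩
  cases h : negNegOne (base.cls b₀) with
  | true => rfl
  | false => rw [h] at hb₀; exact absurd (by decide : bz false = 0) hb₀

/-- ★★ **(★) for the family with one prime `≡ ±3 (mod 8)`: the `0 × V` section of `W_ev(1)` is at most the diagonal section.** For an even
root-number-`−1` base with exactly one prime `P_{b₁}` with `(2/P_{b₁}) = −1`, `dim (W_ev(1) ∩ 0×V) ≤ dim (W_ev(1) ∩ Δ)`. Proof: with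
`B := L + D_d + d·mᵀ`, `W_ev(1) ∩ 0×V ⊆ 0 × ker B` and `{(u,u) : u ∈ ker Bᵀ} ⊆ W_ev(1) ∩ Δ` (the pair `(u, u + u_{b₁}·1)` is an even kernel pair),
and `dim ker B = dim ker Bᵀ`. [cite: HeathBrown1994SelmerCongruentII, Appendix (Monsky), typescript p. 41 L20–L36] -/
theorem finrank_evenPencil_one_inf_ker_fst_le_diag_of_negTwo_one (b₁ : Fin (k + 1)) (hd : ∀ b, negTwo (base.cls b) = true ↔ b = b₁)
    (hμ : (∑ b, bz (negNegOne (base.cls b))) = 1) :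
    finrank (ZMod 2) ↥(base.evenPencil (fun _ => 1) ⊓
        LinearMap.ker (LinearMap.fst (ZMod 2) (Fin (k + 1) → ZMod 2) (Fin (k + 1) → ZMod 2))) ≤
      finrank (ZMod 2) ↥(base.evenPencil (fun _ => 1) ⊓
        LinearMap.ker (LinearMap.fst (ZMod 2) (Fin (k + 1) → ZMod 2) (Fin (k + 1) → ZMod 2) +
          LinearMap.snd (ZMod 2) (Fin (k + 1) → ZMod 2) (Fin (k + 1) → ZMod 2))) := by
  have h2 : ∀ x : ZMod 2, x + x = 0 := by decide
  have h11 : (1 : ZMod 2) + 1 = 0 := h2 1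
  -- `d = e_{b₁}`
  have hdz : ∀ b, bz (negTwo (base.cls b)) = if b = b₁ then 1 else 0 := by
    intro b
    by_cases h : b = b₁
    · rw [if_pos h, (hd b).2 h]; rfl
    · rw [if_neg h]
      cases hnb : negTwo (base.cls b) with
      | true => exact absurd ((hd b).1 hnb) h
      | false => rfl
  have hdx : ∀ x : Fin (k + 1) → ZMod 2, (∑ j, bz (negTwo (base.cls j)) * x j) = x b₁ := by
    intro x
    rw [Finset.sum_congr rfl fun j (_ : j ∈ Finset.univ) => by rw [hdz j]]
    simp
  set Bm : Matrix (Fin (k + 1)) (Fin (k + 1)) (ZMod 2) := Matrix.of fun i j : Fin (k + 1) => bz (base.neg i j) +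
      (if i = j then (∑ l, bz (base.neg i l)) + bz (negTwo (base.cls i)) else 0) +
      bz (negTwo (base.cls i)) * bz (negNegOne (base.cls j)) with hBm
  set δ : Fin (k + 1) → ZMod 2 := fun _ => 1 with hδ
  -- elements of the pencil at `δ = 1`
  have hpen : ∀ p : (Fin (k + 1) → ZMod 2) × (Fin (k + 1) → ZMod 2), p ∈ base.evenPencil δ ↔
      ∃ (u v : Fin (k + 1) → ZMod 2) (γ : ZMod 2), (u, v) ∈ base.evenVirtualKernel ∧ p = (fun b => v b + γ, u) := by
    intro p
    rw [mem_evenPencil_iff]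
    constructor
    · rintro ⟨u, v, γ, hE1, hE2, rfl⟩
      refine ⟨u, v, γ, (mem_evenVirtualKernel_iff base (u, v)).2 ⟨hE1, hE2⟩, Prod.ext ?_ ?_⟩
      · funext b; simp [hδ, h11]
      · funext b; simp [hδ, h11]
    · rintro ⟨u, v, γ, huv, rfl⟩
      obtain ⟨hE1, hE2⟩ := (mem_evenVirtualKernel_iff base (u, v)).1 huv
      refine ⟨u, v, γ, hE1, hE2, Prod.ext ?_ ?_⟩
      · funext b; simp [hδ, h11]
      · funext b; simp [hδ, h11]
  -- (1) the `0 × V` section lies in `0 × ker B`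
  have hCle : base.evenPencil δ ⊓ LinearMap.ker (LinearMap.fst (ZMod 2) (Fin (k + 1) → ZMod 2) (Fin (k + 1) → ZMod 2)) ≤
      (LinearMap.ker Bm.mulVecLin).map (LinearMap.inr (ZMod 2) (Fin (k + 1) → ZMod 2) (Fin (k + 1) → ZMod 2)) := by
    intro p hp
    obtain ⟨hpW, hp0⟩ := Submodule.mem_inf.1 hp
    obtain ⟨u, v, γ, huv, rfl⟩ := (hpen p).1 hpW
    rw [LinearMap.mem_ker, LinearMap.fst_apply] at hp0
    have hv : ∀ b, v b = γ := fun b => by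
      have := congrFun hp0 b
      simp only [Pi.zero_apply] at this
      linear_combination this - h2 γ
    obtain ⟨hE1, hE2⟩ := (mem_evenVirtualKernel_iff base (u, v)).1 huv
    set S := ∑ j, bz (negNegOne (base.cls j)) * u j with hS
    -- the two kernel equations of `(u, γ·1)`
    have e1 : ∀ i, (∑ j, bz (base.neg i j) * (u j + u i)) + bz (negNegOne (base.cls i)) * S +
        bz (negTwo (base.cls i)) * u i + bz (negNegOne (base.cls i)) * γ = 0 := fun i => by
      have e := hE1 i
      simp only [hv] at e
      exact e
    have e2 : ∀ i, bz (negTwo (base.cls i)) * u i + bz (negNegOne (base.cls i)) * γ + bz (negTwo (base.cls i)) * γ +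
        bz (negNegOne (base.cls i)) * S = 0 := fun i => by
      have e := hE2 i
      simp only [hv, lap_const] at e
      linear_combination e
    -- the sum of the first equations: `S + u_{b₁} + γ = 0`
    have esum : S + u b₁ + γ = 0 := by
      have hs : (∑ i, ((∑ j, bz (base.neg i j) * (u j + u i)) + bz (negNegOne (base.cls i)) * S +
          bz (negTwo (base.cls i)) * u i + bz (negNegOne (base.cls i)) * γ)) = 0 :=
        Finset.sum_eq_zero fun i _ => e1 i
      rw [Finset.sum_add_distrib, Finset.sum_add_distrib, Finset.sum_add_distrib, sum_lap_eq_d1 base, hμ, h11, zero_mul,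
        zero_add, ← Finset.sum_mul, hμ, one_mul, hdx, ← Finset.sum_mul, hμ, one_mul] at hs
      exact hs
    refine Submodule.mem_map.2 ⟨u, ?_, ?_⟩
    · rw [LinearMap.mem_ker, mulVecLin_apply]
      funext i
      rw [bmat_mulVec base, Pi.zero_apply, ← hS, hdz i]
      by_cases hi : i = b₁
      · rw [if_pos hi]
        have f1 := e1 i
        have f2 := e2 i
        rw [hdz i, if_pos hi] at f1 f2
        rw [hi] at f1 f2 ⊢
        linear_combination f1 + f2 + esum - h2 (bz (negNegOne (base.cls b₁)) * S) - h2 (bz (negNegOne (base.cls b₁)) * γ) -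
          h2 (u b₁) - h2 γ
      · rw [if_neg hi]
        have f1 := e1 i
        have f2 := e2 i
        rw [hdz i, if_neg hi] at f1 f2
        linear_combination f1 + f2 - h2 (bz (negNegOne (base.cls i)) * S) - h2 (bz (negNegOne (base.cls i)) * γ)
    · refine Prod.ext ?_ rfl
      rw [LinearMap.inr_apply]
      exact hp0.symm
  -- (2) `{(u,u) : u ∈ ker Bᵀ}` lies in the diagonal section
  set Dg : (Fin (k + 1) → ZMod 2) →ₗ[ZMod 2] (Fin (k + 1) → ZMod 2) × (Fin (k + 1) → ZMod 2) :=
    (LinearMap.id : (Fin (k + 1) → ZMod 2) →ₗ[ZMod 2] (Fin (k + 1) → ZMod 2)).prod LinearMap.id with hDg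
  have hDg_inj : Function.Injective Dg := fun a b hab => congrArg Prod.fst hab
  have hHge : (LinearMap.ker Bmᵀ.mulVecLin).map Dg ≤
      base.evenPencil δ ⊓ LinearMap.ker (LinearMap.fst (ZMod 2) (Fin (k + 1) → ZMod 2) (Fin (k + 1) → ZMod 2) +
        LinearMap.snd (ZMod 2) (Fin (k + 1) → ZMod 2) (Fin (k + 1) → ZMod 2)) := by
    intro p hp
    obtain ⟨u, hu, rfl⟩ := Submodule.mem_map.1 hp
    rw [LinearMap.mem_ker, mulVecLin_apply] at hu
    set S := ∑ j, bz (negNegOne (base.cls j)) * u j with hS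
    have hB : ∀ j, (∑ i, bz (base.neg j i) * (u i + u j)) + bz (negNegOne (base.cls j)) * S +
        bz (negNegOne (base.cls j)) * u j + bz (negTwo (base.cls j)) * u j + bz (negNegOne (base.cls j)) * u b₁ = 0 := fun j => by
      have := congrFun hu j
      rwa [bmatT_mulVec base, Pi.zero_apply, hdx] at this
    refine Submodule.mem_inf.2 ⟨?_, ?_⟩
    · rw [hpen]
      refine ⟨u, fun b => u b + u b₁, u b₁, ?_, Prod.ext ?_ rfl⟩
      · rw [mem_evenVirtualKernel_iff]
        refine ⟨fun i => ?_, fun i => ?_⟩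
        · -- (E1) is exactly `Bᵀ u = 0`
          simp only
          rw [← hS]
          linear_combination hB i
        · -- (E2): `L(u + γ1) = Lu`, then `Bᵀ u = 0`
          simp only
          rw [lap_add_const base u (u b₁) i, ← hS, hdz i]
          have f := hB i
          rw [hdz i] at f
          by_cases hi : i = b₁
          · rw [if_pos hi] at f ⊢
            rw [hi] at f ⊢
            linear_combination f + h2 (u b₁)
          · rw [if_neg hi] at f ⊢
            linear_combination f
      · funext b
        show u b = (u b + u b₁) + u b₁
        linear_combination -(h2 (u b₁))
    · rw [LinearMap.mem_ker, LinearMap.add_apply, LinearMap.fst_apply, LinearMap.snd_apply]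
      funext b
      show u b + u b = 0
      exact h2 (u b)
  -- (3) `dim ker Bᵀ = dim ker B`
  have hrank : finrank (ZMod 2) ↥(LinearMap.ker Bmᵀ.mulVecLin) = finrank (ZMod 2) ↥(LinearMap.ker Bm.mulVecLin) := by
    have r1 := LinearMap.finrank_range_add_finrank_ker Bm.mulVecLin
    have r2 := LinearMap.finrank_range_add_finrank_ker Bmᵀ.mulVecLin
    have rt : Bmᵀ.rank = Bm.rank := rank_transpose Bm
    change Bmᵀ.rank + _ = _ at r2
    change Bm.rank + _ = _ at r1
    omega
  have hinr : Function.Injective (LinearMap.inr (ZMod 2) (Fin (k + 1) → ZMod 2) (Fin (k + 1) → ZMod 2)) := LinearMap.inr_injective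
  calc finrank (ZMod 2) ↥(base.evenPencil δ ⊓ LinearMap.ker (LinearMap.fst (ZMod 2) (Fin (k + 1) → ZMod 2) (Fin (k + 1) → ZMod 2)))
      ≤ finrank (ZMod 2) ↥((LinearMap.ker Bm.mulVecLin).map (LinearMap.inr (ZMod 2) (Fin (k + 1) → ZMod 2) (Fin (k + 1) → ZMod 2))) :=
        Submodule.finrank_mono hCle
    _ = finrank (ZMod 2) ↥(LinearMap.ker Bm.mulVecLin) := (LinearEquiv.finrank_eq (Submodule.equivMapOfInjective _ hinr _)).symm
    _ = finrank (ZMod 2) ↥(LinearMap.ker Bmᵀ.mulVecLin) := hrank.symm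
    _ = finrank (ZMod 2) ↥((LinearMap.ker Bmᵀ.mulVecLin).map Dg) := LinearEquiv.finrank_eq (Submodule.equivMapOfInjective _ hDg_inj _)
    _ ≤ _ := Submodule.finrank_mono hHge

/-- ★★ **(★) for the family with one prime `≡ ±3 (mod 8)`, dimension form**: `2 · dim (W_ev(1) ∩ 0×V) ≤ dim 𝒦_ev + 1` (`= 2τ₀` by the kernel
parity). The `0 × V` and diagonal sections are disjoint inside `W_ev(1)` (dimension `dim 𝒦_ev + 1`), and the former is the smaller one.
[cite: HeathBrown1994SelmerCongruentII, Appendix (Monsky), typescript p. 41 L20–L36] -/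
theorem two_mul_finrank_evenPencil_one_inf_ker_fst_le_of_negTwo_one (b₁ : Fin (k + 1)) (hd : ∀ b, negTwo (base.cls b) = true ↔ b = b₁)
    (hμ : (∑ b, bz (negNegOne (base.cls b))) = 1) :
    2 * finrank (ZMod 2) ↥(base.evenPencil (fun _ => 1) ⊓
        LinearMap.ker (LinearMap.fst (ZMod 2) (Fin (k + 1) → ZMod 2) (Fin (k + 1) → ZMod 2))) ≤
      finrank (ZMod 2) ↥base.evenVirtualKernel + 1 := by
  have h2 : ∀ x : ZMod 2, x + x = 0 := by decide
  have hle := finrank_evenPencil_one_inf_ker_fst_le_diag_of_negTwo_one base b₁ hd hμ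
  obtain ⟨b₀, hb₀⟩ := exists_negNegOne_of_sum base hμ
  set C := base.evenPencil (fun _ => 1) ⊓
    LinearMap.ker (LinearMap.fst (ZMod 2) (Fin (k + 1) → ZMod 2) (Fin (k + 1) → ZMod 2)) with hC
  set H := base.evenPencil (fun _ => 1) ⊓
    LinearMap.ker (LinearMap.fst (ZMod 2) (Fin (k + 1) → ZMod 2) (Fin (k + 1) → ZMod 2) +
      LinearMap.snd (ZMod 2) (Fin (k + 1) → ZMod 2) (Fin (k + 1) → ZMod 2)) with hH
  have hCH : C ⊓ H = ⊥ := by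
    rw [Submodule.eq_bot_iff]
    intro p hp
    obtain ⟨hpC, hpH⟩ := Submodule.mem_inf.1 hp
    have h1 : p.1 = 0 := by
      have := (Submodule.mem_inf.1 hpC).2
      rwa [LinearMap.mem_ker, LinearMap.fst_apply] at this
    have h12 : p.1 + p.2 = 0 := by
      have := (Submodule.mem_inf.1 hpH).2
      rwa [LinearMap.mem_ker, LinearMap.add_apply, LinearMap.fst_apply, LinearMap.snd_apply] at this
    have hp2 : p.2 = 0 := by rw [h1, zero_add] at h12; exact h12
    exact Prod.ext h1 hp2
  have hsup : C ⊔ H ≤ base.evenPencil (fun _ => 1) := sup_le inf_le_left inf_le_left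
  have hW := finrank_evenPencil_eq base (fun _ => 1) (evenPencil_one_legit base b₀ hb₀)
  have hsum := Submodule.finrank_sup_add_finrank_inf_eq C H
  rw [hCH, finrank_bot, add_zero] at hsum
  have hmono := Submodule.finrank_mono hsup
  omega

/-- ★★★ **EVEN DOOR AT δ = 1 for one prime `≡ ±3 (mod 8)` (two conditions).** For an even root-number-`−1` base `E_{2·P₀⋯P_k}` with exactly one
prime `P_{b₁}` with `(2/P_{b₁}) = −1`, put `τ₀ := (dim 𝒦_ev + 1)/2`. If the even pencil at `δ = 1` meets `V × 0` and the diagonal in dimension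
`≤ τ₀`, a pattern-free Heegner recipe with `τ₀ + 1` auxiliary primes exists (cells `c₁ :: rest`, `|rest| = τ₀`, `heegnerK`, Monsky's even matrix
invertible for EVERY mutual pattern). [cite: HeathBrown1994SelmerCongruentII, Appendix (Monsky), typescript p. 41 L20–L36] -/
theorem exists_patternFree_even_design_one_of_negTwo_one (b₁ : Fin (k + 1)) (hd : ∀ b, negTwo (base.cls b) = true ↔ b = b₁)
    (hμ : (∑ b, bz (negNegOne (base.cls b))) = 1)
    (h1 : finrank (ZMod 2) ↥(base.evenPencil (fun _ => 1) ⊓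
      LinearMap.ker (LinearMap.snd (ZMod 2) (Fin (k + 1) → ZMod 2) (Fin (k + 1) → ZMod 2))) ≤
        (finrank (ZMod 2) ↥base.evenVirtualKernel + 1) / 2)
    (h3 : finrank (ZMod 2) ↥(base.evenPencil (fun _ => 1) ⊓
      LinearMap.ker (LinearMap.fst (ZMod 2) (Fin (k + 1) → ZMod 2) (Fin (k + 1) → ZMod 2) +
        LinearMap.snd (ZMod 2) (Fin (k + 1) → ZMod 2) (Fin (k + 1) → ZMod 2))) ≤
        (finrank (ZMod 2) ↥base.evenVirtualKernel + 1) / 2) :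
    ∃ (c₁ : AuxCell) (rest : List AuxCell), rest.length = (finrank (ZMod 2) ↥base.evenVirtualKernel + 1) / 2 ∧
      heegnerK base (c₁ :: rest) = true ∧ ∀ pat : ℕ → ℕ → Bool, (dataK base (c₁ :: rest) pat).monskyEvenS.det = 1 := by
  obtain ⟨b₀, hb₀⟩ := exists_negNegOne_of_sum base hμ
  exact exists_patternFree_even_design_pencil_of_odd base hμ (fun _ => 1) (evenPencil_one_legit base b₀ hb₀) h1
    ((finrank_evenPencil_one_inf_ker_fst_le_diag_of_negTwo_one base b₁ hd hμ).trans h3) h3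

/-- ★★★ **The same through the realisation door**: for every even root-number-`−1` base with exactly one prime `≡ ±3 (mod 8)` whose even pencil
at `δ = 1` meets `V × 0` and the diagonal in dimension `≤ τ₀^{ev}`, one cell list `aux` (`τ₀^{ev} + 1` cells, `heegnerK`) such that any realising
primes in the size window give the conclusion of `HeegnerTwistCouplingInSupply` at `(E_{2n}, P₀)`, modulo Burungale–Tian.
[cite: HeathBrown1994SelmerCongruentII, Appendix (Monsky), typescript p. 41 L20–L36] [cite: BurungaleTian2026, Thm. 1.1]
[cite: Oesterle1988Gauss, II §3 Proposition p. 57 (27)] -/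
theorem exists_recipe_cruxOn_even_one_of_negTwo_one (hBT : burungaleTian_analyticRank_eq_zero_of_selmerCorank_eq_zero_of_hasCM)
    (b₁ : Fin (k + 1)) (hd : ∀ b, negTwo (base.cls b) = true ↔ b = b₁) (hμ : (∑ b, bz (negNegOne (base.cls b))) = 1)
    (h1 : finrank (ZMod 2) ↥(base.evenPencil (fun _ => 1) ⊓
      LinearMap.ker (LinearMap.snd (ZMod 2) (Fin (k + 1) → ZMod 2) (Fin (k + 1) → ZMod 2))) ≤
        (finrank (ZMod 2) ↥base.evenVirtualKernel + 1) / 2)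
    (h3 : finrank (ZMod 2) ↥(base.evenPencil (fun _ => 1) ⊓
      LinearMap.ker (LinearMap.fst (ZMod 2) (Fin (k + 1) → ZMod 2) (Fin (k + 1) → ZMod 2) +
        LinearMap.snd (ZMod 2) (Fin (k + 1) → ZMod 2) (Fin (k + 1) → ZMod 2))) ≤
        (finrank (ZMod 2) ↥base.evenVirtualKernel + 1) / 2) :
    ∃ aux : List AuxCell, aux.length = (finrank (ZMod 2) ↥base.evenVirtualKernel + 1) / 2 + 1 ∧ heegnerK base aux = true ∧
      ∀ (P : Fin (k + 1) → ℕ) (q : Fin aux.length → ℕ), RealisesK base aux P q →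
        ∀ (n : ℕ) [(congruentNumberCurve (2 * n)).IsElliptic], (∏ b, P b) = n →
          Real.sqrt ((∏ j, q j : ℕ) : ℝ) * Real.log ((∏ j, q j : ℕ) : ℝ) < Real.pi * P 0 →
          ∃ (K : Type) (_ : Field K) (_ : NumberField K),
            IsImaginaryQuadratic K ∧ 4 < (NumberField.discr K).natAbs ∧
            SatisfiesHeegnerHypothesis ((congruentNumberCurve (2 * n)).conductorNorm ℤ) K ∧
            ((congruentNumberCurve (2 * n)).quadraticTwist (NumberField.discr K : ℚ)).entireLFunction 1 ≠ 0 ∧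
            ¬ P 0 ∣ NumberField.classNumber K := by
  obtain ⟨c₁, rest, hlen, hH, hdet⟩ := exists_patternFree_even_design_one_of_negTwo_one base b₁ hd hμ h1 h3
  refine ⟨c₁ :: rest, by simp [hlen], hH, ?_⟩
  intro P q hR n _ hn hsize
  exact hR.cruxOn_even_of_BT_of_forall hBT hH hdet hn hsize

end NegTwoOneEven

end Summit.BirchSwinnertonDyer.BirchSwinnertonDyer.Theorems.SymbolicMonsky
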